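import Summits.HodgeConjecture.HodgeConjecture.Theorems.Q8QuaternionicTransvectionDensity
import Literature.AlgebraicGeometry.HodgeTheory.ZariskiClosureBaseChange
import Literature.Algebra.Lie.KillingBaseChange
import HarnessLib

/-!
# Route `Q8SymplecticPowers` — the quaternionic Lemma T DESCENDED to the ground field: rational automorphisms commuting with the
# Q₈ pair lie in the identity component of the RATIONAL Zariski closure of a group whose base changes contain quaternionic
# transvections (the exact DENSITY currency of the K1Q kernel on `H²(X; ℚ)`)

Support file for crux K1Q (stmt-HodgeConjecture-24190; `--supports … --as helper`). Prover seat `hodge-nonav-prover-Ax` (g16),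
INTENT (o5). The quaternionic Lemma T (`Q8QuaternionicTransvectionDensity`, p706267) needs `i = √−1` in the field: the eigenspace
`M = ker(τ* − i)` and the quaternionic transvections along vanishing vectors live on `L ⊗_K H²` (`L ∋ i`, e.g. `ℚ(i)` or `ℂ`), while the
K1Q kernel `q8Comm_of_glIdentityComponent_subset_mumfordTateGroup` (p705733) consumes DENSITY for the monodromy group
`Γ ≤ GL(H²(𝒳_t; ℚ))` over `ℚ`. This file bridges the two with route A's descent `mem_glIdentityComponent_of_baseChange`
(`ZariskiClosureBaseChange`, Borel AG 14.2): Zariski-closure membership over `L` of base-changed data implies membership over `K`.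

* `mem_glIdentityComponent_of_quaternionic_baseChange` — `K ⊆ L` fields of characteristic `0`, `i ∈ L` with `i² = −1`; over `K`: `V`,
  `Q` symmetric non-degenerate, `a, b` `Q`-isometries with `a² = b² = −1`, `ab = −ba`, `Γ ≤ GL_K(V)`; over `L`: a set `R` of
  `i`-eigenvectors of `a_L` spanning `ker(a_L − i)` and ω-connected, such that for every `v ∈ R` some element of `Γ` base-changes to a
  quaternionic transvection along `v` with non-zero parameter. Then every `g ∈ GL_K(V)` commuting with `a`, `b` and preserving `Q`
  lies in `glIdentityComponent Γ` — over `K`.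

HONEST FRAMING: pure algebra (axioms standard, no named fact; `nondegenerate_baseChange` from `Literature/Algebra/Lie/KillingBaseChange`);
item 24190 OPEN; no statement about the Hodge conjecture.

## References
* [Deligne1980] P. Deligne, La conjecture de Weil II, Publ. Math. IHÉS 52 (1980), §4.4 (4.4.2^α)–(4.4.4^α).
* [Borel1991] A. Borel, Linear Algebraic Groups, 2nd ed., AG §14.1–14.2 (extension of the ground field), I.1.2.
-/

noncomputable section

set_option linter.dupNamespace false

namespace Summit.HodgeConjecture.HodgeConjecture.Theorems.Q8QuaternionicTransvectionDensity

open scoped TensorProduct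
open Literature.AlgebraicGeometry.Motives Literature.AlgebraicGeometry.HodgeTheory

universe u v w

variable {K : Type u} [Field K] {L : Type w} [Field L] [Algebra K L] {V : Type v} [AddCommGroup V] [Module K V]

/-! ### §1 Base-change bookkeeping -/

/-- Commuting endomorphisms stay commuting after base change. -/
theorem baseChange_comm_apply {f g : V →ₗ[K] V} (h : ∀ x, f (g x) = g (f x)) (x : L ⊗[K] V) :
    f.baseChange L (g.baseChange L x) = g.baseChange L (f.baseChange L x) := by
  have hc : f ∘ₗ g = g ∘ₗ f := LinearMap.ext h
  have := congrArg (fun φ : V →ₗ[K] V => φ.baseChange L) hc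
  simp only [LinearMap.baseChange_comp] at this
  exact LinearMap.congr_fun this x

/-- `a² = −1` survives base change. -/
theorem baseChange_sq_neg {a : V →ₗ[K] V} (haa : ∀ x, a (a x) = -x) (x : L ⊗[K] V) :
    a.baseChange L (a.baseChange L x) = -x := by
  have hc : a ∘ₗ a = -LinearMap.id := LinearMap.ext fun y => by simp [haa]
  have := congrArg (fun φ : V →ₗ[K] V => φ.baseChange L) hc
  simp only [LinearMap.baseChange_comp, LinearMap.baseChange_neg, LinearMap.baseChange_id] at this
  have h := LinearMap.congr_fun this x
  simpa using h

/-- `ab = −ba` survives base change. -/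
theorem baseChange_anticomm {a b : V →ₗ[K] V} (hab : ∀ x, a (b x) = -b (a x)) (x : L ⊗[K] V) :
    a.baseChange L (b.baseChange L x) = -b.baseChange L (a.baseChange L x) := by
  have hc : a ∘ₗ b = -(b ∘ₗ a) := LinearMap.ext fun y => by simp [hab]
  have := congrArg (fun φ : V →ₗ[K] V => φ.baseChange L) hc
  simp only [LinearMap.baseChange_comp, LinearMap.baseChange_neg] at this
  have h := LinearMap.congr_fun this x
  simpa using h

/-- Symmetry survives base change. -/
theorem baseChange_symm {Q : LinearMap.BilinForm K V} (hQs : ∀ x y, Q x y = Q y x) (x y : L ⊗[K] V) :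
    Q.baseChange L x y = Q.baseChange L y x := by
  induction x using TensorProduct.induction_on generalizing y with
  | zero => simp
  | tmul c v =>
    induction y using TensorProduct.induction_on with
    | zero => simp
    | tmul d w => rw [LinearMap.BilinForm.baseChange_tmul, LinearMap.BilinForm.baseChange_tmul, hQs, mul_comm]
    | add y₁ y₂ h₁ h₂ => rw [map_add, map_add, LinearMap.add_apply, h₁, h₂]
  | add x₁ x₂ h₁ h₂ => rw [map_add, LinearMap.add_apply, map_add, h₁, h₂]

/-- Isometries stay isometries after base change. -/
theorem baseChange_isometry {Q : LinearMap.BilinForm K V} {f : V →ₗ[K] V} (hf : ∀ x y, Q (f x) (f y) = Q x y)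
    (x y : L ⊗[K] V) : Q.baseChange L (f.baseChange L x) (f.baseChange L y) = Q.baseChange L x y := by
  induction x using TensorProduct.induction_on generalizing y with
  | zero => simp
  | tmul c v =>
    induction y using TensorProduct.induction_on with
    | zero => simp
    | tmul d w =>
      rw [LinearMap.baseChange_tmul, LinearMap.baseChange_tmul, LinearMap.BilinForm.baseChange_tmul,
        LinearMap.BilinForm.baseChange_tmul, hf]
    | add y₁ y₂ h₁ h₂ => rw [map_add, map_add, map_add, h₁, h₂]
  | add x₁ x₂ h₁ h₂ => rw [map_add, map_add, LinearMap.add_apply, h₁, h₂, map_add, LinearMap.add_apply]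

/-! ### §2 The descended quaternionic Lemma T -/

/-- **QUATERNIONIC LEMMA T over the ground field** (descent). `K ⊆ L` fields of characteristic `0` with `i ∈ L`, `i² = −1`; over
`K`: `V` finite-dimensional, `Q` symmetric non-degenerate, `a, b` `Q`-isometries with `a² = b² = −1`, `ab = −ba`, a subgroup
`Γ ≤ GL_K(V)`; over `L`: `R ⊆ L ⊗_K V` consisting of `i`-eigenvectors of `a_L`, spanning the `i`-eigenspace, ω-orthogonally connected
(`ω(x,y) = Q_L(x, b_L y)`), and for every `v ∈ R` an element of `Γ` whose base change is the quaternionic transvection along `v` with a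
NON-ZERO parameter. Then every `g ∈ GL_K(V)` commuting with `a` and `b` and preserving `Q` lies in `glIdentityComponent Γ` (over `K`):
the quaternionic Lemma T over `L` for `Γ_L` (`mem_glIdentityComponent_of_quaternionic`) and descent
(`mem_glIdentityComponent_of_baseChange`). [cite: Deligne1980, §4.4 Lemme (4.4.2^α)–(4.4.4^α)] [cite: Borel1991, AG §14.2 and I.1.2] -/
theorem mem_glIdentityComponent_of_quaternionic_baseChange [CharZero L] [Module.Finite K V]
    {Q : LinearMap.BilinForm K V} (hQs : ∀ x y, Q x y = Q y x) (hQn : Q.Nondegenerate)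
    {a b : V →ₗ[K] V} (haa : ∀ x, a (a x) = -x) (hbb : ∀ x, b (b x) = -x) (hab : ∀ x, a (b x) = -b (a x))
    (haQ : ∀ x y, Q (a x) (a y) = Q x y) (hQb : ∀ x y, Q (b x) (b y) = Q x y) {i : L} (hi : i * i = -1)
    {R : Set (L ⊗[K] V)} (hRM : ∀ v ∈ R, a.baseChange L v = i • v)
    (hspan : ∀ m : L ⊗[K] V, a.baseChange L m = i • m → m ∈ Submodule.span L R)
    (hconn : ∀ A ⊆ R, A.Nonempty → A ≠ R → ∃ r ∈ A, ∃ ρ ∈ R, ρ ∉ A ∧ Q.baseChange L r (b.baseChange L ρ) ≠ 0)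
    {Γ : Subgroup (V ≃ₗ[K] V)}
    (hΓ : ∀ v ∈ R, ∃ l : L, l ≠ 0 ∧ ∃ T ∈ Γ, ∀ x : L ⊗[K] V,
      glBaseChangeHom K L V T x = x + (l * Q.baseChange L x (b.baseChange L v)) • v + (-(l * Q.baseChange L x v)) • b.baseChange L v)
    {g : V ≃ₗ[K] V} (hga : ∀ x, g (a x) = a (g x)) (hgb : ∀ x, g (b x) = b (g x)) (hgQ : ∀ x y, Q (g x) (g y) = Q x y) :
    g ∈ glIdentityComponent Γ := by
  refine mem_glIdentityComponent_of_baseChange (L := L) ?_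
  have hgL : ∀ x, glBaseChangeHom K L V g x = (g : V →ₗ[K] V).baseChange L x := fun x => rfl
  refine mem_glIdentityComponent_of_quaternionic (K := L) (V := L ⊗[K] V) (Q := Q.baseChange L)
    (a := a.baseChange L) (b := b.baseChange L) (i := i) (baseChange_symm hQs)
    (Literature.Algebra.Lie.KillingBaseChange.nondegenerate_baseChange hQn)
    (baseChange_sq_neg haa) (baseChange_sq_neg hbb) (baseChange_anticomm hab) (baseChange_isometry haQ)
    (baseChange_isometry hQb) hi hRM hspan hconn (Γ := Γ.map (glBaseChangeHom K L V)) ?_ ?_ ?_ ?_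
  · intro v hv
    obtain ⟨l, hl, T, hT, hTx⟩ := hΓ v hv
    exact ⟨l, hl, glBaseChangeHom K L V T, Subgroup.mem_map_of_mem _ hT, hTx⟩
  · intro x
    rw [hgL, hgL]
    exact baseChange_comm_apply (f := (g : V →ₗ[K] V)) (g := a) hga x
  · intro x
    rw [hgL, hgL]
    exact baseChange_comm_apply (f := (g : V →ₗ[K] V)) (g := b) hgb x
  · intro x y
    rw [hgL, hgL]
    exact baseChange_isometry (f := (g : V →ₗ[K] V)) hgQ x y

end Summit.HodgeConjecture.HodgeConjecture.Theorems.Q8QuaternionicTransvectionDensity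

end
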